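import Summits.AtomisticToContinuum.Crystallization.Theorems.FluxCellKepler.Negative.LayeredMinimiser

/-!
# `FluxCellKepler` (stmt-AtomisticToContinuum-15221), negative side III
# — the quantifier order `∀ R ∃ c` is load-bearing; the periodic twin

Continues `Negative/LayeredMinimiser.lean`.

* `not_dom_and_keplerUniformR`: the natural strengthening of the crux in which the defect price `c`
  is chosen BEFORE the scale `R` (and `η`) is FALSE — bounded clusters are all-bad at scale
  `R ≥ diam + 2` (`not_good_of_forall_norm_le`), and the Lennard-Jones ground states have
  `E(N) − N e⋆ = o(N)`.  So `c(δ, R, η) ≲ (E(N) − N e⋆)/N` at `R ≈ diam x^N`.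
* `periodicPricing`: under the crux, for every `(δ, R, η)` some `c > 0` prices the `(R, η)`-bad
  motif classes of EVERY `δ`-separated periodic configuration: `c · motifBad ≤ #F (e(Q) − e⋆)`;
  `not_fluxCellKepler_of_cheap_bad_periodic` is the resulting computational kill criterion
  (a non-close-packed periodic structure tying `e⋆` — none known for LJ 12-6).

Nothing here asserts a route statement; `--supports` the crux.  All `[folklore]`.
-/

noncomputable section

namespace Summit.AtomisticToContinuum.Crystallization.Theorems.FluxCellKepler.Negative

open scoped BigOperators
open Literature.MathematicalPhysics.StatisticalMechanics
open Summit.AtomisticToContinuum.Crystallization.Theses.FluxTubeKepler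

/-! ## The quantifier order `∀ R ∃ c` is load-bearing: `c` uniform in `R` is FALSE

A bounded cluster is ALL-bad at every scale `R ≥ diam + 2` (`not_good_of_forall_norm_le`: the
layered set matched near the origin contains a whole row `p₀ + t·A u(a)`, `‖A u(a)‖ = a ≤ 1`, hence
a point in the shell `R − 1 < ‖p‖ ≤ R`, which no particle can match).  So with `c` chosen before
`R`, KEPLER on the Lennard-Jones ground states `x^N` (uniformly separated, tree fact) at
`R_N = diam + 2` would give `c · N ≤ E(N) − N e(P₀) = E(N) − N e⋆ = o(N)` — absurd
(`not_dom_and_keplerUniformR`).  For the prover: necessarily `c(δ, R, η) ≲ (E(N) − N e⋆)/N` at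
`R ≈ diam(x^N) ~ N^{1/3}`, i.e. `c(R)` decays at least like the surface-to-volume ratio. -/

/-- Norm of the first triangular generator. [folklore] -/
theorem norm_triangularVec₁ (a : ℝ) : ‖triangularVec₁ a‖ = |a| := by
  rw [EuclideanSpace.norm_eq]
  simp [triangularVec₁, Fin.sum_univ_three, Real.sqrt_sq_eq_abs]

/-- A layered set is invariant under its first in-layer translation: `p ∈ S ⇒ p + t·A u(a) ∈ S`.
[folklore] -/
theorem add_zsmul_mem_layeredSet {a : ℝ} {A : E3 →ₗᵢ[ℝ] E3} {s : ℤ → ℤ} {z : ℤ → ℝ} {p : E3}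
    (hp : p ∈ layeredSet a A s z) (t : ℤ) :
    p + (t : ℝ) • A (triangularVec₁ a) ∈ layeredSet a A s z := by
  obtain ⟨m, k, l, rfl⟩ := hp
  refine ⟨m, k + t, l, ?_⟩
  rw [← A.map_smul, ← A.map_add]
  congr 1
  push_cast
  rw [add_smul]
  abel

/-- **Bounded clusters are all-bad at large scale.** If every relative position at site `i` has
norm `≤ D` and `R ≥ D + 2`, `0 < η ≤ 1/2`, then site `i` is `(R, η)`-bad. [folklore] -/
theorem not_good_of_forall_norm_le {R η D : ℝ} {N : ℕ} {x : Fin N → E3} {i : Fin N}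
    (hD : ∀ j, ‖x j - x i‖ ≤ D) (hR : D + 2 ≤ R) (hη : 0 < η) (hη1 : η ≤ 1 / 2) :
    ¬ Good R η x i := by
  rw [good_iff_goodRel]
  rintro ⟨a, ha1, ha2, A, s, z, -, -, h1, h2⟩
  have hD0 : 0 ≤ D := (norm_nonneg _).trans (hD i)
  -- a point of `S` within `η` of the origin (match of the site itself)
  obtain ⟨p₀, hp₀, hd₀⟩ := h2 (x i - x i) ⟨i, rfl⟩ (by rw [sub_self, norm_zero]; linarith)
  rw [sub_self, dist_comm, dist_zero_right] at hd₀
  -- the row `p₀ + t • A u`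
  set w : E3 := A (triangularVec₁ a) with hw
  have hwn : ‖w‖ = a := by
    rw [hw, A.norm_map, norm_triangularVec₁, abs_of_nonneg (by linarith)]
  have hrow : ∀ t : ℕ, p₀ + (t : ℝ) • w ∈ layeredSet a A s z := fun t => by
    have := add_zsmul_mem_layeredSet hp₀ (t : ℤ)
    simpa using this
  -- some point of the row is beyond `R`
  have hex : ∃ t : ℕ, R < ‖p₀ + (t : ℝ) • w‖ := by
    obtain ⟨t, ht⟩ := exists_nat_gt ((R + 1) / a)
    refine ⟨t, ?_⟩
    have hta : R + 1 < t * a := by rwa [div_lt_iff₀ (by linarith)] at ht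
    have : (t : ℝ) * a - ‖p₀‖ ≤ ‖p₀ + (t : ℝ) • w‖ := by
      have h := norm_sub_norm_le ((t : ℝ) • w) (-p₀)
      rw [norm_neg, sub_neg_eq_add, add_comm, norm_smul, Real.norm_of_nonneg (Nat.cast_nonneg t),
        hwn] at h
      linarith
    linarith
  classical
  -- the last point of the row inside the `R`-ball lies in the shell `(R − 1, R]`
  set t₁ := Nat.find hex with ht₁
  have ht₁R : R < ‖p₀ + (t₁ : ℝ) • w‖ := Nat.find_spec hex
  have ht₁pos : 0 < t₁ := by
    by_contra h0
    have : t₁ = 0 := by omega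
    rw [this, Nat.cast_zero, zero_smul, add_zero] at ht₁R
    linarith
  set t₀ := t₁ - 1 with ht₀
  have ht₀le : ‖p₀ + (t₀ : ℝ) • w‖ ≤ R := by
    have := Nat.find_min hex (show t₀ < t₁ by omega)
    exact not_lt.1 this
  have ht₀ge : R - 1 < ‖p₀ + (t₀ : ℝ) • w‖ := by
    have hsucc : (t₁ : ℝ) = t₀ + 1 := by
      have : t₁ = t₀ + 1 := by omega
      exact_mod_cast this
    have : ‖p₀ + (t₁ : ℝ) • w‖ ≤ ‖p₀ + (t₀ : ℝ) • w‖ + a := by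
      rw [hsucc, add_smul, one_smul, ← add_assoc]
      exact (norm_add_le _ _).trans (by rw [hwn])
    linarith
  -- it must be matched by a particle: impossible
  obtain ⟨_, ⟨j, rfl⟩, hj⟩ := h1 _ (hrow t₀) ht₀le
  dsimp only at hj
  have : ‖p₀ + (t₀ : ℝ) • w‖ ≤ ‖x j - x i‖ + η := by
    have h := norm_le_norm_add_norm_sub' (p₀ + (t₀ : ℝ) • w) (x j - x i)
    rw [← dist_eq_norm (p₀ + (t₀ : ℝ) • w) (x j - x i), dist_comm] at h
    linarith
  linarith [hD j]

/-- KEPLER with the defect price `c` chosen BEFORE the scale `R` and the tolerance `η`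
(a natural strengthening of the crux's `∀ δ R η, ∃ c`). [folklore] -/
def KeplerUniformR (P₀ : PeriodicConfiguration 3) (R₁ : ℝ) (τ : Finset E3 → ℝ) : Prop :=
  ∀ δ : ℝ, 0 < δ → ∃ c : ℝ, 0 < c ∧ ∀ R η : ℝ, 0 < R → 0 < η → ∀ (N : ℕ) (x : Fin N → E3),
    Function.Injective x → (∀ i j, i ≠ j → δ ≤ dist (x i) (x j)) →
    c * (Nat.card {i : Fin N // ¬ Good R η x i} : ℝ) ≤
    ∑ i, ((1 / 24 : ℝ) * siteEnergy (fun r => (r⁻¹) ^ 12) x i - (1 / 12 : ℝ) *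
      τ ((Finset.univ.filter fun j : Fin N => dist (x j) (x i) ≤ R₁).image fun j => x j - x i)) -
      (N : ℝ) * P₀.energyPerParticle lennardJones

/-- The uniform version implies the crux's KEPLER. [folklore] -/
theorem KeplerUniformR.kepler {P₀ : PeriodicConfiguration 3} {R₁ : ℝ} {τ : Finset E3 → ℝ}
    (h : KeplerUniformR P₀ R₁ τ) : Kepler P₀ R₁ τ := by
  intro δ hδ R η hR hη
  obtain ⟨c, hc, hK⟩ := h δ hδ
  exact ⟨c, hc, hK R η hR hη⟩

open Summit.AtomisticToContinuum.Crystallization.Theorems.ChargedEnergyGapNegative in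
/-- **The strengthening with `c` uniform in `R` is false** (witness: the Lennard-Jones ground
states at scale `R = diam + 2`, all of whose sites are bad, against `E(N) − N e⋆ = o(N)`).
[folklore] -/
theorem not_dom_and_keplerUniformR :
    ¬ ∃ (P₀ : PeriodicConfiguration 3) (R₁ : ℝ) (τ : Finset E3 → ℝ),
      Dom R₁ τ ∧ KeplerUniformR P₀ R₁ τ := by
  rintro ⟨P₀, R₁, τ, hD, hU⟩
  have hK := hU.kepler
  have he := witness_energy_eq_eStar hD hK
  obtain ⟨δ₀, hδ₀, hsepGS⟩ := LennardJonesMinimalDistance_holds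
  obtain ⟨c, hc, hKc⟩ := hU δ₀ hδ₀
  -- `E(N)/N → e⋆`: pick `N ≥ 1` with `E(N)/N < e⋆ + c/2`
  have hlim := crysEnergyLimit
  have hev : ∀ᶠ N : ℕ in Filter.atTop, groundStateEnergy lennardJones 3 N / N < eStar + c / 2 :=
    hlim (Iio_mem_nhds (by change eStar < eStar + c / 2; linarith))
  obtain ⟨N, hN₀⟩ := Filter.eventually_atTop.1 (hev.and (Filter.eventually_ge_atTop 1))
  obtain ⟨hN, hN1⟩ := hN₀ N le_rfl
  obtain ⟨x, hx⟩ := LennardJonesGroundStatesExist_holds N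
  -- all sites of `x` are `(R, 1/2)`-bad at `R = D + 2`, `D = 2 Σ ‖x i‖`
  set D : ℝ := 2 * ∑ i, ‖x i‖ with hDdef
  have hDij : ∀ i j, ‖x j - x i‖ ≤ D := fun i j => by
    have hi : ‖x i‖ ≤ ∑ k, ‖x k‖ :=
      Finset.single_le_sum (fun k _ => norm_nonneg (x k)) (Finset.mem_univ i)
    have hj : ‖x j‖ ≤ ∑ k, ‖x k‖ :=
      Finset.single_le_sum (fun k _ => norm_nonneg (x k)) (Finset.mem_univ j)
    calc ‖x j - x i‖ ≤ ‖x j‖ + ‖x i‖ := norm_sub_le _ _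
      _ ≤ D := by rw [hDdef]; linarith
  have hD0 : 0 ≤ D := by rw [hDdef]; positivity
  have hbad : ∀ i, ¬ Good (D + 2) (1 / 2) x i := fun i =>
    not_good_of_forall_norm_le (hDij i) le_rfl (by norm_num) le_rfl
  have hcard : Nat.card {i : Fin N // ¬ Good (D + 2) (1 / 2) x i} = N := by
    rw [Nat.card_congr (Equiv.subtypeUnivEquiv hbad), Nat.card_eq_fintype_card, Fintype.card_fin]
  have hkep := hKc (D + 2) (1 / 2) (by linarith) (by norm_num) N x hx.1 (hsepGS N x hx)
  rw [hcard] at hkep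
  -- the right-hand side is at most `E(N) − N e⋆`
  have hdom := hD N x hx.1
  have hrhs : ∑ i, ((1 / 24 : ℝ) * siteEnergy (fun r => (r⁻¹) ^ 12) x i - (1 / 12 : ℝ) *
      τ ((Finset.univ.filter fun j => dist (x j) (x i) ≤ R₁).image fun j => x j - x i)) ≤
      interactionEnergy lennardJones x := by
    rw [interactionEnergy_eq_sum]
    simp only [Finset.sum_sub_distrib, ← Finset.mul_sum]
    linarith
  rw [hx.2] at hrhs
  have hNr : (0 : ℝ) < N := by exact_mod_cast hN1
  rw [div_lt_iff₀ hNr] at hN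
  rw [he] at hkep
  nlinarith

/-! ## The periodic twin: X prices bad motif classes of EVERY periodic configuration

Same block argument with an arbitrary periodic `Q` in place of `P₀`: for every `(δ, R, η)` the
KEPLER constant `c` satisfies `c · #{bad motif classes of Q} ≤ #F · (e(Q) − e⋆)` for every
`δ`-separated periodic `Q` (`periodicPricing`).  Kill criterion for a COMPUTATION: a sequence of
uniformly separated periodic configurations, `(R, η)`-bad at a positive fraction of their motif,
with `e(Q) → e⋆` faster than the bad fraction (`not_fluxCellKepler_of_cheap_bad_periodic`) — i.e. a
non-close-packed structure tying the Lennard-Jones periodic ground-state energy.  None is known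
(bcc, A15, σ, C15, glasses all sit ≥ 2 % above `e(hcp*)` for LJ 12-6), which is WHY the crux
resists. -/

section Periodic

open Summit.AtomisticToContinuum.Crystallization.Theorems.ChargedEnergyGapNegative
open Summit.AtomisticToContinuum.Crystallization.Theorems.ChargedEnergyGapNegative.Blocks

/-- Number of `(R, η)`-bad motif classes of a periodic configuration. [folklore] -/
def motifBad (R η : ℝ) (Q : PeriodicConfiguration 3) : ℕ :=
  Nat.card {m : Q.motif // ¬ GoodRel R η (relSet Q m)}

/-- `motifBad ≤ #F`. [folklore] -/
theorem motifBad_le (R η : ℝ) (Q : PeriodicConfiguration 3) : motifBad R η Q ≤ Q.motif.card := by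
  classical
  unfold motifBad
  rw [Nat.card_eq_fintype_card, ← Fintype.card_coe Q.motif]
  exact Fintype.card_subtype_le _

/-- **Periodic pricing.** Under X, for every `(δ, R, η)` there is `c > 0` with
`c · motifBad R η Q ≤ #F · (e(Q) − e⋆)` for every `δ`-separated periodic `Q`. [folklore] -/
theorem periodicPricing {P₀ : PeriodicConfiguration 3} {R₁ : ℝ} {τ : Finset E3 → ℝ}
    (hD : Dom R₁ τ) (hK : Kepler P₀ R₁ τ) {δ R η : ℝ} (hδ : 0 < δ) (hR : 0 < R) (hη : 0 < η) :
    ∃ c : ℝ, 0 < c ∧ ∀ Q : PeriodicConfiguration 3,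
      (∀ p ∈ Q.points, ∀ q ∈ Q.points, p ≠ q → δ ≤ dist p q) →
      c * (motifBad R η Q : ℝ) ≤
        (Q.motif.card : ℝ) * (Q.energyPerParticle lennardJones - eStar) := by
  classical
  obtain ⟨c, hc, hKc⟩ := hK δ hδ R η hR hη
  have he := witness_energy_eq_eStar hD hK
  refine ⟨c, hc, fun Q hsep => ?_⟩
  by_contra hlt
  push Not at hlt
  have hF : (0 : ℝ) < Q.motif.card := by exact_mod_cast Q.motif_nonempty.card_pos
  set gap : ℝ := c * (motifBad R η Q : ℝ) -
    (Q.motif.card : ℝ) * (Q.energyPerParticle lennardJones - eStar) with hgap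
  have hgap0 : 0 < gap := by rw [hgap]; linarith
  obtain ⟨K₀, hK₀, hKE⟩ := exists_block_energy_le Q (show 0 < gap / (3 * Q.motif.card) by
    positivity)
  set d : ℕ := depth Q (R + 1) with hd
  obtain ⟨K₁, hK₁⟩ := exists_nat_gt (18 * d * c * (motifBad R η Q : ℝ) / gap)
  set K : ℕ := max K₀ (K₁ + 1) with hKdef
  have hKK₀ : K₀ ≤ K := le_max_left _ _
  have hKK₁ : K₁ + 1 ≤ K := le_max_right _ _
  have hK1r : (K₁ : ℝ) + 1 ≤ K := by exact_mod_cast hKK₁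
  have hKpos : (0 : ℝ) < K := by linarith [show (0 : ℝ) ≤ K₁ from Nat.cast_nonneg K₁]
  set x := blockConfig Q K with hxdef
  have hinj : Function.Injective x := blockConfig_injective Q K
  have hmem : ∀ i, x i ∈ Q.points := fun i => by
    rw [hxdef, blockConfig_apply]; exact bpt_mem Q K _
  have hsepx : ∀ i j, i ≠ j → δ ≤ dist (x i) (x j) := fun i j hij =>
    hsep _ (hmem i) _ (hmem j) (hinj.ne hij)
  have hkep := hKc _ x hinj hsepx
  change c * (Nat.card {i // ¬ Good R η x i} : ℝ) ≤ _ at hkep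
  have hdom := hD _ x hinj
  have hE := hKE K hKK₀
  have hn : ((Fintype.card (BIdx Q K) : ℕ) : ℝ) = Q.motif.card * (K : ℝ) ^ 3 := by
    exact_mod_cast card_BIdx Q K
  rw [← hxdef, hn] at hE
  have hrhs : ∑ i, ((1 / 24 : ℝ) * siteEnergy (fun r => (r⁻¹) ^ 12) x i - (1 / 12 : ℝ) *
      τ ((Finset.univ.filter fun j => dist (x j) (x i) ≤ R₁).image fun j => x j - x i)) ≤
      interactionEnergy lennardJones x := by
    rw [interactionEnergy_eq_sum]
    simp only [Finset.sum_sub_distrib, ← Finset.mul_sum]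
    linarith
  rw [hn, he] at hkep
  -- bad block sites: at least `(#deep) · motifBad`
  let f : {k : Fin 3 → Fin K // IsDeep K d k} × {m : Q.motif // ¬ GoodRel R η (relSet Q m)} →
      {i // ¬ Good R η x i} := fun p =>
    ⟨Fintype.equivFin (BIdx Q K) (p.2.1, p.1.1), fun hg => p.2.2 (by
      have := goodRel_relSet_of_good Q K (u := (p.2.1, p.1.1)) p.1.2 hg
      rwa [bpt, relSet_add Q (latVec_mem Q _)] at this)⟩
  have hf : Function.Injective f := by
    rintro ⟨⟨k, hk⟩, ⟨m, hm⟩⟩ ⟨⟨k', hk'⟩, ⟨m', hm'⟩⟩ h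
    have h' := congrArg (fun w => (Fintype.equivFin (BIdx Q K)).symm w.1) h
    simp only [f, Equiv.symm_apply_apply, Prod.mk.injEq] at h'
    obtain ⟨rfl, rfl⟩ := h'
    rfl
  have hcard := Nat.card_le_card_of_injective f hf
  rw [Nat.card_prod] at hcard
  have hdeep := card_deep_ge K d
  have h1 : ((K : ℝ) ^ 3 - 6 * d * (K : ℝ) ^ 2) * (motifBad R η Q : ℝ) ≤
      (Nat.card {i // ¬ Good R η x i} : ℝ) := by
    have hdk : ((K : ℝ) ^ 3 - 6 * d * (K : ℝ) ^ 2) ≤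
        (Nat.card {k : Fin 3 → Fin K // IsDeep K d k} : ℝ) := by
      have := (Nat.cast_le (α := ℝ)).2 hdeep; push_cast at this ⊢; linarith
    have h2 : ((Nat.card {k : Fin 3 → Fin K // IsDeep K d k} : ℕ) : ℝ) * (motifBad R η Q : ℝ) ≤
        (Nat.card {i // ¬ Good R η x i} : ℝ) := by exact_mod_cast hcard
    nlinarith [Nat.cast_nonneg (α := ℝ) (motifBad R η Q)]
  -- `6 d c mB K² ≤ (gap/3) K³`
  have hsmall : 6 * d * c * (motifBad R η Q : ℝ) * (K : ℝ) ^ 2 ≤ gap / 3 * (K : ℝ) ^ 3 := by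
    have h3 : 18 * d * c * (motifBad R η Q : ℝ) / gap < K := by linarith
    rw [div_lt_iff₀ hgap0] at h3
    have hK2 : (0 : ℝ) ≤ (K : ℝ) ^ 2 := by positivity
    nlinarith
  have hK3 : (0 : ℝ) < (K : ℝ) ^ 3 := by positivity
  have key : (K : ℝ) ^ 3 * (c * (motifBad R η Q : ℝ) - gap / 3) ≤
      (K : ℝ) ^ 3 *
        ((Q.motif.card : ℝ) * (Q.energyPerParticle lennardJones - eStar) + gap / 3) := by
    have hE' : interactionEnergy lennardJones x ≤
        (Q.motif.card : ℝ) * (K : ℝ) ^ 3 * Q.energyPerParticle lennardJones +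
          (K : ℝ) ^ 3 * (gap / 3) := by
      have : (Q.motif.card : ℝ) * (K : ℝ) ^ 3 * (gap / (3 * Q.motif.card)) =
          (K : ℝ) ^ 3 * (gap / 3) := by
        field_simp
      nlinarith
    have hc1 := mul_le_mul_of_nonneg_left h1 hc.le
    nlinarith
  have := le_of_mul_le_mul_left key hK3
  rw [hgap] at this
  linarith

/-- **Kill criterion (cheap bad periodic competitors).** If for some `(δ, R, η)` and every
`κ > 0` there is a `δ`-separated periodic `Q` with `#F · (e(Q) − e⋆) < κ · motifBad R η Q`, then
`FluxCellKepler` is false. [folklore] -/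
theorem not_fluxCellKepler_of_cheap_bad_periodic {δ R η : ℝ} (hδ : 0 < δ) (hR : 0 < R)
    (hη : 0 < η)
    (h : ∀ κ : ℝ, 0 < κ → ∃ Q : PeriodicConfiguration 3,
      (∀ p ∈ Q.points, ∀ q ∈ Q.points, p ≠ q → δ ≤ dist p q) ∧
      (Q.motif.card : ℝ) * (Q.energyPerParticle lennardJones - eStar) <
        κ * (motifBad R η Q : ℝ)) :
    ¬ FluxCellKepler := by
  rw [fluxCellKepler_iff]
  rintro ⟨P₀, R₁, τ, hD, hK⟩
  obtain ⟨c, hc, hP⟩ := periodicPricing hD hK hδ hR hη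
  obtain ⟨Q, hsep, hlt⟩ := h c hc
  exact absurd (hP Q hsep) (not_le.2 hlt)

end Periodic

end Summit.AtomisticToContinuum.Crystallization.Theorems.FluxCellKepler.Negative

end
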